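import Mathlib
import Summits.ValiantsHypothesis.ValiantsHypothesis.Theses.BarrierLever
import Summits.ValiantsHypothesis.ValiantsHypothesis.Theorems.BarrierLeverDefinableEquationsDegreeWindow
import Summits.ValiantsHypothesis.ValiantsHypothesis.Theorems.BarrierLeverDefinableEquationsDegreeWindowThin
import HarnessLib

/-!
# Crux `BarrierLever.DefinableEquations` (stmt-8745) ⟺ `SingleSizeEquations` (stmt-8749) —
# the DEGREE-WINDOW DOOR at the route declarations

Leaf file (imports the route file) over the route-independent pair
`…DegreeWindow.lean` (pullback of window Boolean-sum data; the window of `SmallCircuits ℂ n b` at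
degree `d` is a class of FORMS of size `≤ (d+2)² n^b`) and `…DegreeWindowThin.lean` (window
equations EXIST as soon as `4s + 1 < C(n+d-1, d)`, constant count).

* `singleSizeEquations_of_window_equations` — if for every size exponent `b` there are a FIXED
  degree `d = d(b)`, a level `a = a(b)` and `n₀` such that for all `n ≥ n₀` a level-`a`
  Boolean-sum datum in the `C(n+d-1,d)` degree-`d` coefficient variables (`q ≤ N^a` Boolean
  variables, complexity and degree `≤ N^a`, `N = C(2n,n)`) has a NONZERO Boolean sum vanishing at
  `coeff_d(g)` for every FORM `g` of degree `d` and circuit size `≤ (d+2)² n^b`, then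
  `BarrierLever.SingleSizeEquations` (stmt-8749) — hence the crux `DefinableEquations` (stmt-8745)
  by the tree's `definableEquations_of_singleSizeEquations`.
* `definableEquations_of_window_equations` — the same with ONE level `a` for all `b` gives the
  crux `BarrierLever.DefinableEquations` directly.
* `window_door_nonvacuous` — for every `b` the hypothesis CLASS at `d = b + 1` does carry nonzero
  (non-explicit) window equations eventually in `n` (sibling `exists_windowEquation_forms_eventually`):
  the door is not vacuous in CONSTANT degree `b + 1`; at the open rung `b = 2`: cubic forms of
  size `≤ 25 n²`, `n ≥ 599` (`cubicForms_thin_two`).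

READING (honest).  The crux at `b` ⟸ "an EXPLICIT equation — a Boolean sum of size `2^{O(n)}`
over `2^{O(n)}` Boolean variables, degree `2^{O(n)}` — for degree-`(b+1)` forms in `n` variables of
circuit size `≤ (b+3)² n^b`", a class one power of `n` below the generic size of such forms, in an
ambient space of dimension `C(n+b, b+1) = poly(n)` where the budget `N^a` is EXPONENTIAL.  It is a
DOOR (sufficient, not equivalent), and it PINS the size exponent against the degree: the class of
degree-`(b+1)` forms of size `n^{b+1}` is everything, so no argument that loses a polynomial factor
in size can open or shut it.  No explicit window equation is known at `b = 2` (coordinate rank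
methods die on `ℓ · q`, strength one; resultant/discriminant-type invariants, affordable at budget
`2^{O(n)}`, die on the Fermat cubic; see the seat memo LANDSCAPE-8749-g22.md).  Verdicts
unchanged: 8745/8749 OPEN at `b = 2` (Chatterjee–Tengse 2023 §1.3 dir. 2); nothing on crux 14610
or on `VP ≠ VNP`, which is NOT proved.  No definitions, no named facts; standard axioms.

References: Forbes–Shpilka–Volk 2018, Def. 1; Bürgisser–Clausen–Shokrollahi 1997, Lemma (21.25),
§9.1, Thm. (9.13); Chatterjee–Tengse, arXiv:2309.07612, §1.3.
-/

set_option linter.dupNamespace false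

noncomputable section

namespace Summit.ValiantsHypothesis.ValiantsHypothesis.Theorems.BarrierLeverDefinableEquations

open MvPolynomial
open Literature.Computability.AlgebraicComplexity Literature.Barriers.ValiantsHypothesis
open scoped BigOperators

namespace DegreeWindow

/-- **The degree-window door for the support item / the crux.** Explicit (level-`a(b)`
Boolean-sum) equations in a FIXED-degree window `d(b)`, vanishing on the degree-`d` forms of size
`≤ (d+2)² n^b`, for every `b`, give `BarrierLever.SingleSizeEquations` (stmt-ValiantsHypothesis-8749).
[cite: ForbesShpilkaVolk2018, Def. 1] -/
theorem singleSizeEquations_of_window_equations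
    (hE : ∀ b : ℕ, ∃ d a n₀ : ℕ, ∀ n ≥ n₀, ∃ q : ℕ, q ≤ (Nat.choose (2 * n) n) ^ a ∧
      ∃ H' : MvPolynomial (GKSS2017.homMonomials n d ⊕ Fin q) ℂ,
        complexity H' ≤ (Nat.choose (2 * n) n) ^ a ∧ H'.totalDegree ≤ (Nat.choose (2 * n) n) ^ a ∧
        boolSum H' ≠ 0 ∧
        ∀ g : MvPolynomial (Fin n) ℂ, g.IsHomogeneous d → complexity g ≤ (d + 2) ^ 2 * n ^ b →
          eval (coeffVector (GKSS2017.homMonomials n d) g) (boolSum H') = 0) :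
    Summit.ValiantsHypothesis.ValiantsHypothesis.Theses.BarrierLever.SingleSizeEquations := by
  intro b
  obtain ⟨d, a, n₀, h⟩ := hE b
  exact singleSize_at_of_window_equations b d ⟨a, n₀, h⟩

/-- **The degree-window door for the crux with one level**: explicit level-`a` Boolean-sum
equations in fixed-degree windows `d(b)`, ONE `a` for every `b`, give
`BarrierLever.DefinableEquations` (stmt-ValiantsHypothesis-8745). [cite: ForbesShpilkaVolk2018, Def. 1] -/
theorem definableEquations_of_window_equations
    (hE : ∃ a : ℕ, ∀ b : ℕ, ∃ d n₀ : ℕ, ∀ n ≥ n₀, ∃ q : ℕ, q ≤ (Nat.choose (2 * n) n) ^ a ∧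
      ∃ H' : MvPolynomial (GKSS2017.homMonomials n d ⊕ Fin q) ℂ,
        complexity H' ≤ (Nat.choose (2 * n) n) ^ a ∧ H'.totalDegree ≤ (Nat.choose (2 * n) n) ^ a ∧
        boolSum H' ≠ 0 ∧
        ∀ g : MvPolynomial (Fin n) ℂ, g.IsHomogeneous d → complexity g ≤ (d + 2) ^ 2 * n ^ b →
          eval (coeffVector (GKSS2017.homMonomials n d) g) (boolSum H') = 0) :
    Summit.ValiantsHypothesis.ValiantsHypothesis.Theses.BarrierLever.DefinableEquations := by
  obtain ⟨a, ha⟩ := hE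
  exact ⟨a, definable_shape_of_window_equations ha⟩

/-- **The door is not vacuous in constant degree `b + 1`.** For every `b`, eventually in `n`, the
hypothesis class of the door at `d = b + 1` — forms of degree `b + 1` and size `≤ (b+3)² n^b` — is
annihilated by a NONZERO polynomial in the `C(n+b, b+1)` window variables (constant count; not
explicit). Conjunction with the door itself, for the record. [cite: BurgisserClausenShokrollahi1997, Thm. (9.13)] -/
theorem window_door_nonvacuous (b : ℕ) :
    (∃ n₀ : ℕ, ∀ n ≥ n₀, ∃ E : MvPolynomial (GKSS2017.homMonomials n (b + 1)) ℂ, E ≠ 0 ∧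
      ∀ g : MvPolynomial (Fin n) ℂ, g.IsHomogeneous (b + 1) →
        complexity g ≤ (b + 1 + 2) ^ 2 * n ^ b →
        eval (coeffVector (GKSS2017.homMonomials n (b + 1)) g) E = 0) ∧
    ((∃ a n₀ : ℕ, ∀ n ≥ n₀, ∃ q : ℕ, q ≤ (Nat.choose (2 * n) n) ^ a ∧
      ∃ H' : MvPolynomial (GKSS2017.homMonomials n (b + 1) ⊕ Fin q) ℂ,
        complexity H' ≤ (Nat.choose (2 * n) n) ^ a ∧ H'.totalDegree ≤ (Nat.choose (2 * n) n) ^ a ∧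
        boolSum H' ≠ 0 ∧
        ∀ g : MvPolynomial (Fin n) ℂ, g.IsHomogeneous (b + 1) →
          complexity g ≤ (b + 1 + 2) ^ 2 * n ^ b →
          eval (coeffVector (GKSS2017.homMonomials n (b + 1)) g) (boolSum H') = 0) →
    ∃ a n₀ : ℕ, ∀ n ≥ n₀, ∃ q : ℕ, q ≤ (Nat.choose (2 * n) n) ^ a ∧
      ∃ H : MvPolynomial (↥(degLEMonomials n) ⊕ Fin q) ℂ,
        complexity H ≤ (Nat.choose (2 * n) n) ^ a ∧ H.totalDegree ≤ (Nat.choose (2 * n) n) ^ a ∧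
        boolSum H ≠ 0 ∧
        ∀ f ∈ SmallCircuits ℂ n b, eval (coeffVector (degLEMonomials n) f) (boolSum H) = 0) :=
  ⟨exists_windowEquation_forms_eventually b, singleSize_at_of_window_equations b (b + 1)⟩

end DegreeWindow

end Summit.ValiantsHypothesis.ValiantsHypothesis.Theorems.BarrierLeverDefinableEquations
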